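import Literature.NumberTheory.Automorphic.ResGLnCuspidalEigenclassOfClean
import Literature.NumberTheory.Automorphic.GL2CArchOps
import Literature.NumberTheory.Automorphic.HarishChandraGLTwist
import Literature.NumberTheory.Automorphic.ImaginaryQuadraticArchimedeanGL
import HarnessLib

/-!
# The six operators on the space of forms of a clean cuspidal representation of `GL₂` over a
# totally complex field, with Casimir scalars from the cohomological infinity type

For an automorphic representation datum `π = W / W'` of `GL_n(𝔸_K)` (Borel–Jacquet model) with
`W' = ⊥` ("clean"), the Lie algebra action on the quotient (from `HasArchParameter` /
`HasInfinityType`: `HasLieAction`) is transported to `W` itself (`lieOnW`, acting by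
`lieDerivW`, i.e. by the Lie derivatives `X φ` of forms); at a complex place `w` its
`𝔤𝔩_n(ℂ)`-factor `rhoAt` keeps the Harish-Chandra parameter (`hasHCParameter_rhoAt`,
`HasHCParameter.of_conj`).  For `n = 2` and `K` totally complex this yields the six lawful operators
`opsW` of `GL2CArchOps.opsOf (ofRho (rhoAt …))` on `↥W`, and — when the `a`-exponents of the
infinity type are the cohomological ones of the dual weights `λ_τ^∨` — the Casimir scalars
**`Ω_L = ½ d_σ(d_σ + 2)`, `Ω_R = ½ d_σ̄(d_σ̄ + 2)`** with `d_τ = λ_{τ,0} − λ_{τ,1}` at the embedding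
`σ` of the place and its conjugate `σ̄` (`casL_casR_opsW`) [cite: Harder1987, §3.1]
[cite: Knapp2002, Thm. 5.44] [cite: BorelWallach2000, I Thm. 5.3 and III 1.5].

Theorems and definitions (`quotEquivW`, `lieOnW`, `rhoAt`, `opsW`); no named fact.
-/

noncomputable section

-- Mathlib idiom (Mathlib/Algebra/Lie/OfAssociative.lean), as in `GL2ComplexCasimirScalar` and `AutomorphicRepsGL`:
-- commutator brackets on matrix algebras and on `Module.End`.
attribute [local instance 100] LieRing.ofAssociativeRing

open scoped Matrix ComplexConjugate Classical
open Complex NumberField NumberField.mixedEmbedding NumberField.InfinitePlace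

namespace Literature.NumberTheory.Automorphic

namespace AutomorphicRepData

open Literature.NumberTheory.DiophantineGeometry Literature.Barriers.Langlands

variable {n : ℕ} {K : Type} [Field K] [NumberField K] {hcpt : isCompact_glFiniteIntegralLevel n K}
  (π : AutomorphicRepData (AutomorphyDatum.gl n K hcpt))

/-! ### Transport of the Lie algebra action to `W` for clean data -/

/-- For `W' = ⊥` the kernel of `W → W / W'` is trivial. [folklore] -/
theorem kerQuot_eq_bot (h : π.W' = ⊥) : π.kerQuot = ⊥ := by
  rw [kerQuot, h, Submodule.comap_bot, Submodule.ker_subtype]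

/-- For `W' = ⊥`: the identification `W / W' ≃ W`. [folklore] -/
def quotEquivW (h : π.W' = ⊥) : π.Quot ≃ₗ[ℂ] π.W :=
  Submodule.quotEquivOfEqBot _ (π.kerQuot_eq_bot h)

/-- `quotEquivW [φ] = φ`. [folklore] -/
@[simp] theorem quotEquivW_mkQ (h : π.W' = ⊥) (φ : π.W) : π.quotEquivW h (π.mkQ φ) = φ :=
  Submodule.quotEquivOfEqBot_apply_mk _ _ φ

/-- `(quotEquivW)⁻¹ φ = [φ]`. [folklore] -/
@[simp] theorem quotEquivW_symm_apply (h : π.W' = ⊥) (φ : π.W) :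
    (π.quotEquivW h).symm φ = π.mkQ φ := by
  rw [LinearEquiv.symm_apply_eq, quotEquivW_mkQ]

/-- **The Lie algebra action on `W`** (clean data): the action `ρ𝔤` on `W / W'` conjugated by
`W / W' ≃ W`. [cite: BorelJacquetCorvallis1979, 4.6 with §1.5] -/
def lieOnW (h : π.W' = ⊥)
    (ρ𝔤 : (AutomorphyDatum.gl n K hcpt).arch.lie →ₗ⁅ℝ⁆ Module.End ℂ π.Quot) :
    (AutomorphyDatum.gl n K hcpt).arch.lie →ₗ⁅ℝ⁆ Module.End ℂ π.W where
  toFun X := (π.quotEquivW h).toLinearMap ∘ₗ ρ𝔤 X ∘ₗ (π.quotEquivW h).symm.toLinearMap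
  map_add' X Y := by rw [map_add, LinearMap.add_comp, LinearMap.comp_add]
  map_smul' r X := by
    refine LinearMap.ext fun φ => ?_
    simp only [map_smul, LinearMap.comp_apply, LinearMap.smul_apply, RingHom.id_apply,
      LinearEquiv.coe_toLinearMap, LinearMap.map_smul_of_tower]
  map_lie' {X Y} := by
    refine LinearMap.ext fun φ => ?_
    rw [LieHom.map_lie]
    simp only [Ring.lie_def, LinearMap.comp_apply, LinearMap.sub_apply, Module.End.mul_apply,
      LinearEquiv.coe_toLinearMap, LinearEquiv.symm_apply_apply, map_sub]

/-- Unfolding: `lieOnW X φ = e (ρ𝔤 X [φ])`. [folklore] -/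
theorem lieOnW_apply (h : π.W' = ⊥)
    (ρ𝔤 : (AutomorphyDatum.gl n K hcpt).arch.lie →ₗ⁅ℝ⁆ Module.End ℂ π.Quot)
    (X : (AutomorphyDatum.gl n K hcpt).arch.lie) (φ : π.W) :
    π.lieOnW h ρ𝔤 X φ = π.quotEquivW h (ρ𝔤 X (π.mkQ φ)) := by
  rw [← quotEquivW_symm_apply π h]; rfl

/-- **`lieOnW` acts by the Lie derivatives**: `lieOnW X φ = X φ` (`lieDerivW`) for the Lie algebra
action of `π`. [cite: BorelJacquetCorvallis1979, 4.6 with §1.5] -/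
theorem lieOnW_eq_lieDerivW (h : π.W' = ⊥)
    {ρ𝔤 : (AutomorphyDatum.gl n K hcpt).arch.lie →ₗ⁅ℝ⁆ Module.End ℂ π.Quot} (hρ : π.HasLieAction ρ𝔤)
    (X : (AutomorphyDatum.gl n K hcpt).arch.lie) (φ : π.W) :
    π.lieOnW h ρ𝔤 X φ = π.lieDerivW X φ := by
  rw [lieOnW_apply, hρ X φ, quotEquivW_mkQ]

/-- As functions on `GL_n(𝔸_K)`: `lieOnW X φ` is the Lie derivative `X φ` through right translation.
[cite: BorelJacquetCorvallis1979, §1.5] -/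
theorem coe_lieOnW (h : π.W' = ⊥)
    {ρ𝔤 : (AutomorphyDatum.gl n K hcpt).arch.lie →ₗ⁅ℝ⁆ Module.End ℂ π.Quot} (hρ : π.HasLieAction ρ𝔤)
    (X : (AutomorphyDatum.gl n K hcpt).arch.lie) (φ : π.W) :
    ((π.lieOnW h ρ𝔤 X φ : π.W) : (AdelicGroupData.gl n K).Adelic → ℂ) =
      lieDeriv (AutomorphyDatum.gl n K hcpt).ofArch X φ := by
  rw [lieOnW_eq_lieDerivW π h hρ]; rfl

/-! ### The factor at a complex place -/

/-- The `𝔤𝔩_n(ℂ)`-factor at the complex place `w` of a real Lie algebra representation of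
`𝔤 = 𝔤𝔩_n(K_∞)` (`complexPlaceLie`, through `𝔤 = ⊤ ≃ 𝔤𝔩_n(mixedSpace K)`). [cite: Clozel1990, §3.3] -/
def rhoAt {V : Type*} [AddCommGroup V] [Module ℂ V]
    (ρW : (AutomorphyDatum.gl n K hcpt).arch.lie →ₗ⁅ℝ⁆ Module.End ℂ V)
    (w : {w : InfinitePlace K // w.IsComplex}) : Matrix (Fin n) (Fin n) ℂ →ₗ⁅ℝ⁆ Module.End ℂ V :=
  (ρW.comp (LieSubalgebra.topEquiv :
      (⊤ : LieSubalgebra ℝ (Matrix (Fin n) (Fin n) (mixedSpace K))) ≃ₗ⁅ℝ⁆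
        Matrix (Fin n) (Fin n) (mixedSpace K)).symm.toLieHom).comp (complexPlaceLie n w)

/-- Unfolding `rhoAt`. [folklore] -/
theorem rhoAt_apply {V : Type*} [AddCommGroup V] [Module ℂ V]
    (ρW : (AutomorphyDatum.gl n K hcpt).arch.lie →ₗ⁅ℝ⁆ Module.End ℂ V)
    (w : {w : InfinitePlace K // w.IsComplex}) (X : Matrix (Fin n) (Fin n) ℂ) :
    rhoAt ρW w X = ρW ((LieSubalgebra.topEquiv :
      (⊤ : LieSubalgebra ℝ (Matrix (Fin n) (Fin n) (mixedSpace K))) ≃ₗ⁅ℝ⁆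
        Matrix (Fin n) (Fin n) (mixedSpace K)).symm (complexPlaceLie n w X)) := rfl

/-- **The factor at a complex place of the action on `W` has the Harish-Chandra parameter of `π`
there**: if `π` (clean) has archimedean parameter `χ` through `ρ𝔤`, then
`rhoAt (lieOnW ρ𝔤) w` has Harish-Chandra parameter `τ ↦ χ (τ ∘ σ_w)` (transport along
`W / W' ≃ W`, `HasHCParameter.of_conj`). [cite: Clozel1990, §3.3] [cite: Knapp2002, Thm. 5.44] -/
theorem hasHCParameter_rhoAt (h : π.W' = ⊥)
    {ρ𝔤 : (AutomorphyDatum.gl n K hcpt).arch.lie →ₗ⁅ℝ⁆ Module.End ℂ π.Quot}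
    {χ : (K →+* ℂ) → Multiset ℂ}
    (hχ : Literature.NumberTheory.Automorphic.HasArchParameter
      (ρ𝔤.comp (LieSubalgebra.topEquiv :
        (⊤ : LieSubalgebra ℝ (Matrix (Fin n) (Fin n) (mixedSpace K))) ≃ₗ⁅ℝ⁆
          Matrix (Fin n) (Fin n) (mixedSpace K)).symm.toLieHom) χ)
    (w : {w : InfinitePlace K // w.IsComplex}) :
    HasHCParameter (𝕜 := ℂ) (rhoAt (π.lieOnW h ρ𝔤) w)
      fun τ => χ ((τ : ℂ →ₐ[ℝ] ℂ).toRingHom.comp w.1.embedding) := by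
  have hw := hχ.2 w
  refine HasHCParameter.of_conj (π.quotEquivW h) (fun X v => ?_) hw
  rw [rhoAt_apply, lieOnW_apply, ← quotEquivW_symm_apply π h, LinearEquiv.symm_apply_apply]
  rfl

end AutomorphicRepData

/-! ### `n = 2`, `K` totally complex: the six operators and their Casimir scalars -/

namespace GL2CCuspForm

open AutomorphicRepData GL2CKType GLnComplexCasimir Literature.NumberTheory.DiophantineGeometry
  Literature.Barriers.Langlands ImaginaryQuadratic

variable {K : Type} [Field K] [NumberField K] [IsTotallyComplex K]
  {hcpt : isCompact_glFiniteIntegralLevel 2 K} (π : AutomorphicRepData (AutomorphyDatum.gl 2 K hcpt))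

/-- **The six operators `L(E), L(F), L(H), R(E), R(F), R(H)` on the forms `W` of a clean `π`** of
`GL₂` over a totally complex `K`, at the chosen complex place `w₀ = complexPlace K`:
`opsOf (ofRho (rhoAt (lieOnW ρ𝔤) w₀))`. [cite: Harder1987, §3.1] [cite: Knapp2002, §VI.1] -/
def opsW (h : π.W' = ⊥) (ρ𝔤 : (AutomorphyDatum.gl 2 K hcpt).arch.lie →ₗ⁅ℝ⁆ Module.End ℂ π.Quot) :
    Ops π.W :=
  opsOf (ofRho (rhoAt (π.lieOnW h ρ𝔤) (complexPlace K)))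

/-- The six operators on `W` are lawful. [cite: Knapp2002, §VI.1] -/
theorem isLawful_opsW (h : π.W' = ⊥)
    (ρ𝔤 : (AutomorphyDatum.gl 2 K hcpt).arch.lie →ₗ⁅ℝ⁆ Module.End ℂ π.Quot) :
    (opsW π h ρ𝔤).IsLawful :=
  isLawful_opsOf (ofRho (rhoAt (π.lieOnW h ρ𝔤) (complexPlace K)))

/-- The embedding of `K` at the chosen complex place. [folklore] -/
def σ₀ : K →+* ℂ := (complexPlace K).1.embedding

omit [NumberField K] [IsTotallyComplex K] in
/-- The `a`-exponents of the cohomological infinity type of the dual weight `λ^∨ = (−λ₁, −λ₀)` of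
`GL₂` are `{−λ₁ + ½, −λ₀ − ½}`. [cite: BorelWallach2000, III 1.5] -/
theorem cohomological_map_a (wt : Fin 2 → ℤ) (τ : K →+* ℂ) :
    (cohomologicalInfinityType 2 K (Weight.dual wt) τ).map ArchWeight.a =
      {-(wt 1 : ℂ) + 2⁻¹, -(wt 0 : ℂ) - 2⁻¹} := by
  rw [cohomologicalInfinityType_apply, Multiset.map_map]
  have : (Finset.univ.val : Multiset (Fin 2)) = {0, 1} := rfl
  rw [this]
  have h0 : (ArchWeight.a ∘ cohomologicalArchWeight 2 (Weight.dual wt)) 0 = -(wt 1 : ℂ) + 2⁻¹ := by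
    simp only [Function.comp_apply, cohomologicalArchWeight_a, Weight.dual, rhoGL]
    rw [show Fin.rev (0 : Fin 2) = 1 from rfl, show ((0 : Fin 2) : ℕ) = 0 from rfl]; push_cast; ring
  have h1 : (ArchWeight.a ∘ cohomologicalArchWeight 2 (Weight.dual wt)) 1 = -(wt 0 : ℂ) - 2⁻¹ := by
    simp only [Function.comp_apply, cohomologicalArchWeight_a, Weight.dual, rhoGL]
    rw [show Fin.rev (1 : Fin 2) = 0 from rfl, show ((1 : Fin 2) : ℕ) = 1 from rfl]; push_cast; ring
  rw [Multiset.insert_eq_cons, Multiset.map_cons, Multiset.map_singleton, h0, h1]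
  rfl

/-- **The Casimir scalars of a clean cohomological `π`.**  If `π` (with `W' = ⊥`) has an infinity
type `T` whose `a`-exponents at every embedding `τ` are those of the cohomological type of the dual
weight `λ_τ^∨`, then on `W` the operators `Ω_L`, `Ω_R` at the place `w₀` (embedding `σ₀`, conjugate
`σ̄₀`) act by `½ d_{σ₀}(d_{σ₀} + 2)` and `½ d_{σ̄₀}(d_{σ̄₀} + 2)`, `d_τ = λ_{τ,0} − λ_{τ,1}`.
[cite: Harder1987, §3.1] [cite: Knapp2002, Thm. 5.44] -/
theorem casL_casR_opsW (h : π.W' = ⊥) {lam : (K →+* ℂ) → Fin 2 → ℤ} {T : InfinityType K 2}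
    {ρ𝔤 : (AutomorphyDatum.gl 2 K hcpt).arch.lie →ₗ⁅ℝ⁆ Module.End ℂ π.Quot}
    (hχ : Literature.NumberTheory.Automorphic.HasArchParameter
      (ρ𝔤.comp (LieSubalgebra.topEquiv :
        (⊤ : LieSubalgebra ℝ (Matrix (Fin 2) (Fin 2) (mixedSpace K))) ≃ₗ⁅ℝ⁆
          Matrix (Fin 2) (Fin 2) (mixedSpace K)).symm.toLieHom) fun σ => (T σ).map ArchWeight.a)
    (hTa : ∀ τ : K →+* ℂ, (T τ).map ArchWeight.a =
      (cohomologicalInfinityType 2 K (Weight.dual (lam τ)) τ).map ArchWeight.a) :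
    (∀ v, (opsW π h ρ𝔤).casL v =
      ((2 : ℂ)⁻¹ * (((lam σ₀ 0 - lam σ₀ 1 : ℤ) : ℂ) * (((lam σ₀ 0 - lam σ₀ 1 : ℤ) : ℂ) + 2))) • v) ∧
    (∀ v, (opsW π h ρ𝔤).casR v =
      ((2 : ℂ)⁻¹ * (((lam (ComplexEmbedding.conjugate σ₀) 0 - lam (ComplexEmbedding.conjugate σ₀) 1 : ℤ) : ℂ) *
        (((lam (ComplexEmbedding.conjugate σ₀) 0 - lam (ComplexEmbedding.conjugate σ₀) 1 : ℤ) : ℂ) + 2))) • v) := by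
  have hHC := π.hasHCParameter_rhoAt h hχ (complexPlace K)
  -- the two embeddings through `w₀`: `id ∘ σ₀ = σ₀`, `conj ∘ σ₀ = σ̄₀`
  have hid : ((AlgHom.id ℝ ℂ : ℂ →ₐ[ℝ] ℂ).toRingHom.comp (complexPlace K).1.embedding) = (σ₀ : K →+* ℂ) :=
    RingHom.ext fun x => rfl
  have hconj : ((Complex.conjAe : ℂ →ₐ[ℝ] ℂ).toRingHom.comp (complexPlace K).1.embedding) =
      ComplexEmbedding.conjugate (σ₀ : K →+* ℂ) := RingHom.ext fun x => rfl
  have hs : (fun τ : ℂ →ₐ[ℝ] ℂ => (T (τ.toRingHom.comp (complexPlace K).1.embedding)).map ArchWeight.a)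
      (AlgHom.id ℝ ℂ) = {-(lam σ₀ 1 : ℂ) + 2⁻¹, -(lam σ₀ 0 : ℂ) - 2⁻¹} := by
    simp only [hid, hTa, cohomological_map_a]
  have ht : (fun τ : ℂ →ₐ[ℝ] ℂ => (T (τ.toRingHom.comp (complexPlace K).1.embedding)).map ArchWeight.a)
      (Complex.conjAe : ℂ →ₐ[ℝ] ℂ) =
      {-(lam (ComplexEmbedding.conjugate σ₀) 1 : ℂ) + 2⁻¹, -(lam (ComplexEmbedding.conjugate σ₀) 0 : ℂ) - 2⁻¹} := by
    simp only [hconj, hTa, cohomological_map_a]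
  obtain ⟨hL, hR⟩ := casL_casR_of_hasHCParameter (rhoAt (π.lieOnW h ρ𝔤) (complexPlace K)) hHC hs ht
  refine ⟨fun v => ?_, fun v => ?_⟩
  · rw [opsW, hL]; congr 1; push_cast; ring
  · rw [opsW, hR]; congr 1; push_cast; ring

end GL2CCuspForm

end Literature.NumberTheory.Automorphic

end
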